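import Literature.MathematicalPhysics.QuantumFieldTheory.Balaban1983to89.Setup
import HarnessLib

/-!
# Crux stmt-QuantumFields-19936 `HistoryTailL` — S-ALIGN brick P: THE ROOTED COARSE POTENTIAL `U_y(z) = κ_y(y)⁻¹ κ_y(z)` OF A SMALL-LINK GAUGE
# (size along a unit staircase, independence of the gauge, the exact one-link transport identity)

Cell `ym3-torus` (rung R3 = YM₃ on T³ — a RUNG, NOT the Clay problem), width seat `ym-ust-19936-w3` gen 12, `--supports stmt-QuantumFields-19936 --as helper`.
Summons w2 g11 02:42:44Z «w3 g12: S-ALIGN».  The smoothing gauge of the sharp step interpolates, over each coarse cell, the logarithms of the ROOTED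
POTENTIAL `U_y(z) := κ_y(y)⁻¹·κ_y(z)` of a coarse gauge `κ_y` in which the coarse field `G` has `w`-small links near `y` (an axial gauge; supplied by
the caller).  THIS FILE is the group-level bookkeeping (any `GaugeGroup`), def-free — the unit staircase from `r` to `r + δ` (`δ ∈ {−1,0,1}^d`) is
written out as `m ↦ (i ↦ r i + (if i < m then δ i else 0))`:
* `potential_tgt_eq` — the EXACT transport identity `U_r(c₊) = U_r(c₋)·(κ(c₋)⁻¹ (G^κ c)⁻¹ κ(c₋))·G c` (middle factor of size `dist1 (G^κ c)`);
* ★ `dist1_potential_le` — `dist1 U_r(r+δ) ≤ d·(X + w)` when `G` is `X`-small and `G^κ` `w`-small on the staircase;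
* ★★ `dist1_potential_mul_inv_potential_le` — TWO such gauges have potentials within `2d·w` of each other (`dist1 (U¹ (U²)⁻¹) ≤ 2dw`): the
  potential is the holonomy up to `O(w)`, whatever the gauge;
* `stair_mem_cube`, `stair_mem_cube_unshift` — the staircase stays in the unit cube around `r` (and around `r − e_μ` when `δ_μ ≤ 0`).
-/

noncomputable section

namespace Summit.QuantumFields.YangMills.Theorems.PoincareLipschitzHierAlignPotential

open Literature.MathematicalPhysics.QuantumFieldTheory.Balaban1983to89

variable {P : Params} {k : ℕ} {G : Type*} [GaugeGroup G]

/-! ## §1 The transport identity -/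

/-- ★ **EXACT TRANSPORT**: `κ(r)⁻¹κ(c₊) = (κ(r)⁻¹κ(c₋))·(κ(c₋)⁻¹·(G^κ c)⁻¹·κ(c₋))·G c`. [folklore] -/
theorem potential_tgt_eq (Gf : GaugeField P k G) (κ : GaugeTransf P k G) (r : Site P k) (c : PBond P k) :
    (κ r)⁻¹ * κ c.tgt = ((κ r)⁻¹ * κ c.src) * ((κ c.src)⁻¹ * (GaugeField.gaugeAct κ Gf c)⁻¹ * κ c.src) * Gf c := by
  unfold GaugeField.gaugeAct
  group

/-- The middle factor has the size of the gauged link: `dist1 (κ(s)⁻¹ (G^κ c)⁻¹ κ(s)) = dist1 (G^κ c)`. [folklore] -/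
theorem dist1_conj_inv_gaugeAct (Gf : GaugeField P k G) (κ : GaugeTransf P k G) (c : PBond P k) :
    dist1 ((κ c.src)⁻¹ * (GaugeField.gaugeAct κ Gf c)⁻¹ * κ c.src) = dist1 (GaugeField.gaugeAct κ Gf c) := by
  have h := GaugeGroup.dist1_conj (GaugeField.gaugeAct κ Gf c)⁻¹ (κ c.src)⁻¹
  rw [inv_inv] at h
  rw [h, GaugeGroup.dist1_inv]

/-- `dist1 (a b c) ≤ dist1 a + dist1 b + dist1 c`. [folklore] -/
theorem dist1_mul_mul_le (a b c : G) : dist1 (a * b * c) ≤ dist1 a + dist1 b + dist1 c :=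
  (GaugeGroup.dist1_mul_le _ _).trans (by have := GaugeGroup.dist1_mul_le a b; linarith)

/-! ## §2 The unit staircase -/

/-- Off the active coordinate the staircase does not move at step `m`. [folklore] -/
theorem stair_succ_apply_of_ne (r : Site P k) (δ : Fin P.d → ℤ) {m : ℕ} {i : Fin P.d} (hi : (i : ℕ) ≠ m) :
    (r i + if (i : ℕ) < m + 1 then ((δ i : ℤ) : ZMod (P.sitesPerDir k)) else 0) =
      r i + if (i : ℕ) < m then ((δ i : ℤ) : ZMod (P.sitesPerDir k)) else 0 := by
  have : ((i : ℕ) < m + 1) ↔ ((i : ℕ) < m) := by omega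
  simp only [this]

/-- Step `m` with `δ_m = 0`: the staircase stays. [folklore] -/
theorem stair_succ_of_zero (r : Site P k) (δ : Fin P.d → ℤ) {m : ℕ} (hm : m < P.d) (h0 : δ ⟨m, hm⟩ = 0) :
    (fun i => r i + if (i : ℕ) < m + 1 then ((δ i : ℤ) : ZMod (P.sitesPerDir k)) else 0) =
      (fun i => r i + if (i : ℕ) < m then ((δ i : ℤ) : ZMod (P.sitesPerDir k)) else 0) := by
  funext i
  by_cases hi : (i : ℕ) = m
  · have hiμ : i = ⟨m, hm⟩ := Fin.ext hi
    subst hiμ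
    simp [h0]
  · exact stair_succ_apply_of_ne r δ hi

/-- Step `m` with `δ_m = 1`: the staircase moves by `+e_m`. [folklore] -/
theorem stair_succ_of_one (r : Site P k) (δ : Fin P.d → ℤ) {m : ℕ} (hm : m < P.d) (h1 : δ ⟨m, hm⟩ = 1) :
    (fun i => r i + if (i : ℕ) < m + 1 then ((δ i : ℤ) : ZMod (P.sitesPerDir k)) else 0) =
      Site.shift (fun i => r i + if (i : ℕ) < m then ((δ i : ℤ) : ZMod (P.sitesPerDir k)) else 0) ⟨m, hm⟩ := by
  funext i
  by_cases hi : (i : ℕ) = m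
  · have hiμ : i = ⟨m, hm⟩ := Fin.ext hi
    subst hiμ
    simp [Site.shift, h1]
  · have hne : i ≠ ⟨m, hm⟩ := fun h => hi (by rw [h])
    rw [Site.shift, Function.update_of_ne hne]
    exact stair_succ_apply_of_ne r δ hi

/-- Step `m` with `δ_m = −1`: the staircase moves by `−e_m` (the OLD site is the shift of the NEW one). [folklore] -/
theorem stair_of_neg_one (r : Site P k) (δ : Fin P.d → ℤ) {m : ℕ} (hm : m < P.d) (h1 : δ ⟨m, hm⟩ = -1) :
    (fun i => r i + if (i : ℕ) < m then ((δ i : ℤ) : ZMod (P.sitesPerDir k)) else 0) =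
      Site.shift (fun i => r i + if (i : ℕ) < m + 1 then ((δ i : ℤ) : ZMod (P.sitesPerDir k)) else 0) ⟨m, hm⟩ := by
  funext i
  by_cases hi : (i : ℕ) = m
  · have hiμ : i = ⟨m, hm⟩ := Fin.ext hi
    subst hiμ
    simp [Site.shift, h1]
  · have hne : i ≠ ⟨m, hm⟩ := fun h => hi (by rw [h])
    rw [Site.shift, Function.update_of_ne hne]
    exact (stair_succ_apply_of_ne r δ hi).symm

/-- At `m = 0` the staircase is at the root. [folklore] -/
theorem stair_zero (r : Site P k) (δ : Fin P.d → ℤ) :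
    (fun i => r i + if (i : ℕ) < 0 then ((δ i : ℤ) : ZMod (P.sitesPerDir k)) else 0) = r := by
  funext i; simp

/-- At `m = d` the staircase is at `r + δ`. [folklore] -/
theorem stair_d (r : Site P k) (δ : Fin P.d → ℤ) :
    (fun i => r i + if (i : ℕ) < P.d then ((δ i : ℤ) : ZMod (P.sitesPerDir k)) else 0) =
      fun i => r i + ((δ i : ℤ) : ZMod (P.sitesPerDir k)) := by
  funext i; simp [i.2]

/-- The staircase stays in the unit cube around `r`. [folklore] -/
theorem stair_mem_cube (r : Site P k) (δ : Fin P.d → ℤ) (hδ : ∀ i, -1 ≤ δ i ∧ δ i ≤ 1) (m : ℕ) (i : Fin P.d) :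
    ∃ e : ℤ, -1 ≤ e ∧ e ≤ 1 ∧
      (r i + if (i : ℕ) < m then ((δ i : ℤ) : ZMod (P.sitesPerDir k)) else 0) = r i + ((e : ℤ) : ZMod (P.sitesPerDir k)) := by
  by_cases h : (i : ℕ) < m
  · exact ⟨δ i, (hδ i).1, (hδ i).2, by simp [h]⟩
  · exact ⟨0, by norm_num, by norm_num, by simp [h]⟩

/-- When `δ_μ ≤ 0` the staircase also stays in the unit cube around `r − e_μ` (used for the root `r = y + e_μ` seen from `y`). [folklore] -/
theorem stair_mem_cube_unshift (r : Site P k) (δ : Fin P.d → ℤ) (hδ : ∀ i, -1 ≤ δ i ∧ δ i ≤ 1) (μ : Fin P.d) (hμ : δ μ ≤ 0)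
    (m : ℕ) (i : Fin P.d) :
    ∃ e : ℤ, -1 ≤ e ∧ e ≤ 1 ∧
      (r i + if (i : ℕ) < m then ((δ i : ℤ) : ZMod (P.sitesPerDir k)) else 0) =
        Site.unshift r μ i + ((e : ℤ) : ZMod (P.sitesPerDir k)) := by
  by_cases hiμ : i = μ
  · subst hiμ
    rw [Site.unshift, Function.update_self]
    by_cases h : (i : ℕ) < m
    · refine ⟨δ i + 1, by linarith [(hδ i).1], by linarith, ?_⟩
      simp only [h, if_true]; push_cast; ring
    · exact ⟨1, by norm_num, by norm_num, by simp only [h, if_false]; push_cast; ring⟩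
  · rw [Site.unshift, Function.update_of_ne hiμ]
    exact stair_mem_cube r δ hδ m i

/-! ## §3 The size of the potential and its independence of the gauge -/

/-- ★ **SIZE OF THE ROOTED POTENTIAL**: if on a set `S` containing the staircase from `r` to `r + δ` the field is `X`-small and its
`κ`-gauged links are `w`-small, then `dist1 (κ(r)⁻¹ κ(r+δ)) ≤ d·(X + w)`. [folklore] -/
theorem dist1_potential_le (Gf : GaugeField P k G) (κ : GaugeTransf P k G) (r : Site P k) (δ : Fin P.d → ℤ)
    (hδ : ∀ i, δ i = -1 ∨ δ i = 0 ∨ δ i = 1) (S : Set (Site P k))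
    (hS : ∀ m : ℕ, (fun i => r i + if (i : ℕ) < m then ((δ i : ℤ) : ZMod (P.sitesPerDir k)) else 0) ∈ S)
    {X w : ℝ} (hX0 : 0 ≤ X) (hw0 : 0 ≤ w)
    (hb : ∀ c : PBond P k, c.src ∈ S → c.tgt ∈ S → dist1 (Gf c) ≤ X ∧ dist1 (GaugeField.gaugeAct κ Gf c) ≤ w) :
    dist1 ((κ r)⁻¹ * κ (fun i => r i + ((δ i : ℤ) : ZMod (P.sitesPerDir k)))) ≤ P.d * (X + w) := by
  have key : ∀ m : ℕ, m ≤ P.d →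
      dist1 ((κ r)⁻¹ * κ (fun i => r i + if (i : ℕ) < m then ((δ i : ℤ) : ZMod (P.sitesPerDir k)) else 0)) ≤ m * (X + w) := by
    intro m
    induction m with
    | zero => intro _; rw [stair_zero, inv_mul_cancel, GaugeGroup.dist1_one]; simp
    | succ m ih =>
      intro hm
      have hm' : m < P.d := by omega
      have ih' := ih hm'.le
      push_cast
      rcases hδ ⟨m, hm'⟩ with h | h | h
      · -- δ_m = -1 : new site is `old.unshift`, i.e. old = new.shift
        set c : PBond P k := ⟨(fun i => r i + if (i : ℕ) < m + 1 then ((δ i : ℤ) : ZMod (P.sitesPerDir k)) else 0), ⟨m, hm'⟩⟩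
          with hc
        have htgt : c.tgt = (fun i => r i + if (i : ℕ) < m then ((δ i : ℤ) : ZMod (P.sitesPerDir k)) else 0) := by
          rw [PBond.tgt, hc]; exact (stair_of_neg_one r δ hm' h).symm
        have hid := potential_tgt_eq Gf κ r c
        rw [htgt] at hid
        obtain ⟨hX, hw⟩ := hb c (hS (m + 1)) (by rw [htgt]; exact hS m)
        -- U(new) = U(old) · (G c)⁻¹ · M⁻¹
        have e : (κ r)⁻¹ * κ c.src =
            ((κ r)⁻¹ * κ (fun i => r i + if (i : ℕ) < m then ((δ i : ℤ) : ZMod (P.sitesPerDir k)) else 0)) * (Gf c)⁻¹ *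
              ((κ c.src)⁻¹ * (GaugeField.gaugeAct κ Gf c)⁻¹ * κ c.src)⁻¹ := by
          rw [hid]; group
        have hsrc : c.src = (fun i => r i + if (i : ℕ) < m + 1 then ((δ i : ℤ) : ZMod (P.sitesPerDir k)) else 0) := by
          rw [hc]
        rw [← hsrc, e]
        refine (dist1_mul_mul_le _ _ _).trans ?_
        rw [GaugeGroup.dist1_inv, GaugeGroup.dist1_inv, dist1_conj_inv_gaugeAct]
        linarith
      · rw [stair_succ_of_zero r δ hm' h]
        linarith
      · -- δ_m = 1 : new = old.shift
        set c : PBond P k := ⟨(fun i => r i + if (i : ℕ) < m then ((δ i : ℤ) : ZMod (P.sitesPerDir k)) else 0), ⟨m, hm'⟩⟩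
          with hc
        have htgt : c.tgt = (fun i => r i + if (i : ℕ) < m + 1 then ((δ i : ℤ) : ZMod (P.sitesPerDir k)) else 0) := by
          rw [PBond.tgt, hc]; exact (stair_succ_of_one r δ hm' h).symm
        have hid := potential_tgt_eq Gf κ r c
        rw [htgt] at hid
        obtain ⟨hX, hw⟩ := hb c (hS m) (by rw [htgt]; exact hS (m + 1))
        rw [hid]
        refine (dist1_mul_mul_le _ _ _).trans ?_
        rw [dist1_conj_inv_gaugeAct]
        have hsrc : c.src = (fun i => r i + if (i : ℕ) < m then ((δ i : ℤ) : ZMod (P.sitesPerDir k)) else 0) := by rw [hc]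
        rw [hsrc] at *
        linarith
  have h := key P.d le_rfl
  rwa [stair_d] at h

/-- ★★ **INDEPENDENCE OF THE GAUGE**: two gauges `κ₁, κ₂` whose gauged links are `w`-small on a set `S` containing the staircase from `r`
to `r + δ` have rooted potentials within `2d·w`: `dist1 ((κ₁(r)⁻¹κ₁(r+δ))·(κ₂(r)⁻¹κ₂(r+δ))⁻¹) ≤ 2dw`. [folklore] -/
theorem dist1_potential_mul_inv_potential_le (Gf : GaugeField P k G) (κ₁ κ₂ : GaugeTransf P k G) (r : Site P k) (δ : Fin P.d → ℤ)
    (hδ : ∀ i, δ i = -1 ∨ δ i = 0 ∨ δ i = 1) (S : Set (Site P k))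
    (hS : ∀ m : ℕ, (fun i => r i + if (i : ℕ) < m then ((δ i : ℤ) : ZMod (P.sitesPerDir k)) else 0) ∈ S)
    {w : ℝ} (hw0 : 0 ≤ w)
    (hb : ∀ c : PBond P k, c.src ∈ S → c.tgt ∈ S →
      dist1 (GaugeField.gaugeAct κ₁ Gf c) ≤ w ∧ dist1 (GaugeField.gaugeAct κ₂ Gf c) ≤ w) :
    dist1 (((κ₁ r)⁻¹ * κ₁ (fun i => r i + ((δ i : ℤ) : ZMod (P.sitesPerDir k)))) *
        ((κ₂ r)⁻¹ * κ₂ (fun i => r i + ((δ i : ℤ) : ZMod (P.sitesPerDir k))))⁻¹) ≤ 2 * P.d * w := by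
  have key : ∀ m : ℕ, m ≤ P.d →
      dist1 (((κ₁ r)⁻¹ * κ₁ (fun i => r i + if (i : ℕ) < m then ((δ i : ℤ) : ZMod (P.sitesPerDir k)) else 0)) *
        ((κ₂ r)⁻¹ * κ₂ (fun i => r i + if (i : ℕ) < m then ((δ i : ℤ) : ZMod (P.sitesPerDir k)) else 0))⁻¹) ≤ 2 * m * w := by
    intro m
    induction m with
    | zero => intro _; rw [stair_zero, inv_mul_cancel, inv_mul_cancel, mul_inv_cancel, GaugeGroup.dist1_one]; simp
    | succ m ih =>
      intro hm
      have hm' : m < P.d := by omega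
      have ih' := ih hm'.le
      push_cast
      rcases hδ ⟨m, hm'⟩ with h | h | h
      · -- δ_m = -1
        set c : PBond P k := ⟨(fun i => r i + if (i : ℕ) < m + 1 then ((δ i : ℤ) : ZMod (P.sitesPerDir k)) else 0), ⟨m, hm'⟩⟩
          with hc
        have htgt : c.tgt = (fun i => r i + if (i : ℕ) < m then ((δ i : ℤ) : ZMod (P.sitesPerDir k)) else 0) := by
          rw [PBond.tgt, hc]; exact (stair_of_neg_one r δ hm' h).symm
        have hsrc : c.src = (fun i => r i + if (i : ℕ) < m + 1 then ((δ i : ℤ) : ZMod (P.sitesPerDir k)) else 0) := by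
          rw [hc]
        obtain ⟨hw1, hw2⟩ := hb c (hS (m + 1)) (by rw [htgt]; exact hS m)
        have hid1 := potential_tgt_eq Gf κ₁ r c
        have hid2 := potential_tgt_eq Gf κ₂ r c
        rw [htgt] at hid1 hid2
        -- abbreviations
        set A1 := (κ₁ r)⁻¹ * κ₁ (fun i => r i + if (i : ℕ) < m then ((δ i : ℤ) : ZMod (P.sitesPerDir k)) else 0) with hA1
        set A2 := (κ₂ r)⁻¹ * κ₂ (fun i => r i + if (i : ℕ) < m then ((δ i : ℤ) : ZMod (P.sitesPerDir k)) else 0) with hA2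
        set M1 := (κ₁ c.src)⁻¹ * (GaugeField.gaugeAct κ₁ Gf c)⁻¹ * κ₁ c.src with hM1
        set M2 := (κ₂ c.src)⁻¹ * (GaugeField.gaugeAct κ₂ Gf c)⁻¹ * κ₂ c.src with hM2
        have e1 : (κ₁ r)⁻¹ * κ₁ c.src = A1 * (Gf c)⁻¹ * M1⁻¹ := by rw [hid1]; group
        have e2 : (κ₂ r)⁻¹ * κ₂ c.src = A2 * (Gf c)⁻¹ * M2⁻¹ := by rw [hid2]; group
        rw [← hsrc, e1, e2]
        have e : A1 * (Gf c)⁻¹ * M1⁻¹ * (A2 * (Gf c)⁻¹ * M2⁻¹)⁻¹ =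
            (A1 * A2⁻¹) * ((A2 * (Gf c)⁻¹) * (M1⁻¹ * M2) * (A2 * (Gf c)⁻¹)⁻¹) := by group
        rw [e]
        refine (GaugeGroup.dist1_mul_le _ _).trans ?_
        rw [GaugeGroup.dist1_conj]
        have hM : dist1 (M1⁻¹ * M2) ≤ w + w := by
          refine (GaugeGroup.dist1_mul_le _ _).trans ?_
          rw [GaugeGroup.dist1_inv, hM1, hM2, dist1_conj_inv_gaugeAct, dist1_conj_inv_gaugeAct]
          linarith
        linarith
      · rw [stair_succ_of_zero r δ hm' h]
        linarith
      · -- δ_m = 1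
        set c : PBond P k := ⟨(fun i => r i + if (i : ℕ) < m then ((δ i : ℤ) : ZMod (P.sitesPerDir k)) else 0), ⟨m, hm'⟩⟩
          with hc
        have htgt : c.tgt = (fun i => r i + if (i : ℕ) < m + 1 then ((δ i : ℤ) : ZMod (P.sitesPerDir k)) else 0) := by
          rw [PBond.tgt, hc]; exact (stair_succ_of_one r δ hm' h).symm
        have hsrc : c.src = (fun i => r i + if (i : ℕ) < m then ((δ i : ℤ) : ZMod (P.sitesPerDir k)) else 0) := by rw [hc]
        obtain ⟨hw1, hw2⟩ := hb c (hS m) (by rw [htgt]; exact hS (m + 1))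
        have hid1 := potential_tgt_eq Gf κ₁ r c
        have hid2 := potential_tgt_eq Gf κ₂ r c
        rw [htgt] at hid1 hid2
        rw [hid1, hid2]
        set A1 := (κ₁ r)⁻¹ * κ₁ c.src with hA1
        set A2 := (κ₂ r)⁻¹ * κ₂ c.src with hA2
        set M1 := (κ₁ c.src)⁻¹ * (GaugeField.gaugeAct κ₁ Gf c)⁻¹ * κ₁ c.src with hM1
        set M2 := (κ₂ c.src)⁻¹ * (GaugeField.gaugeAct κ₂ Gf c)⁻¹ * κ₂ c.src with hM2
        have e : A1 * M1 * Gf c * (A2 * M2 * Gf c)⁻¹ = (A1 * A2⁻¹) * (A2 * (M1 * M2⁻¹) * A2⁻¹) := by group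
        rw [e]
        refine (GaugeGroup.dist1_mul_le _ _).trans ?_
        rw [GaugeGroup.dist1_conj]
        have hM : dist1 (M1 * M2⁻¹) ≤ w + w := by
          refine (GaugeGroup.dist1_mul_le _ _).trans ?_
          rw [GaugeGroup.dist1_inv, hM1, hM2, dist1_conj_inv_gaugeAct, dist1_conj_inv_gaugeAct]
          linarith
        rw [hsrc] at hA1 hA2
        rw [hA1, hA2] at ih'
        have : dist1 (A1 * A2⁻¹) ≤ 2 * m * w := by rw [hA1, hA2]; exact ih'
        linarith
  have h := key P.d le_rfl
  rwa [stair_d] at h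

end Summit.QuantumFields.YangMills.Theorems.PoincareLipschitzHierAlignPotential

end
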